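import Summits.HodgeConjecture.HodgeConjecture.Theorems.EightfoldBlochSeedsChernCharacterOnBettiAnalytificationComplex
import Summits.HodgeConjecture.HodgeConjecture.Theorems.EightfoldBlochSeedsChernCharacterOnBettiAnalytificationExpand
import Literature.AlgebraicTopology.CharacteristicClasses.FramedBundleIso
import HarnessLib

/-!
# K1 (analytification bridge), step K1b: two topological analytifications of one algebraic vector
# bundle are isomorphic (Serre's uniqueness of `F ↦ F^h`), hence have the same Chern classes

Route `EightfoldBlochSeeds` / item `stmt-HodgeConjecture-19780` (`ChernCharacterOnBetti`), helper
(`--supports`). HONEST FRAMING: nothing here proves 19780 / 18880 / 18882 / 18883 / H2 / HC_AV / HC;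
no definition, no named fact.

WHAT. A topological comparison datum `(E, α)` for an `𝒪_X`-module `F` (steps 1–3: a complex vector
bundle `E` on `X(ℂ)` with comparison maps `α_U : Γ(F, U) → sections of E`, additive, `𝒪_X`-linear,
restriction-compatible, continuous on `U(ℂ)`, algebraic frames ↦ fibrewise bases) is unique up to
a unique isomorphism matching the comparison maps (Serre, GAGA §3 n°9–10: `F^h` is a functor and the
comparison `F' → F^h` is universal). Topologically:

* `exists_iso_of_comparison` — **for two data `(E, α)`, `(E', α')` of the same `F` (frames of size `r`
  near every point) there is a `ComplexVectorBundle.Iso e : E ≅ E'` with `e(α_U(σ)(P)) = α'_U(σ)(P)`**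
  for every open `U ∋ P.pt` and `σ ∈ Γ(F, U)`. Construction: over `U(ℂ)` for a framed `U` both
  restricted bundles are framed by `α_U(t)`, `α'_U(t)`, so `ComplexVectorBundle.exists_iso_of_frames` (`FramedBundleIso`) gives
  a local isomorphism matching the frames, hence (step 4, `comparison_eq_of_frame`) matching `α` and
  `α'` on ALL sections; these local isomorphisms therefore agree on overlaps (a fibre map is
  determined by a basis), and glue to a global one whose continuity is local;
* `chernClassZ_eq_of_comparison`, `chernClassIn_eq_of_comparison` — hence **the Betti Chern classes
  (integral, and with any coefficients) of an algebraic vector bundle do not depend on the chosen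
  analytification datum** ((C₁), `theChernClassTheory.chernClass_congr`): the well-definedness
  (`ch_congr` half) of `ChernCharacterBetti.ch` built from steps 2–3.

[cite: SerreGAGA1956, §3 n°9 Déf. 2 and Prop. 10] [cite: MilnorStasheff1974, §2 Thm. 2.2 and Lemma 2.3]
[cite: HusemollerFibreBundles1994, Ch. 17 §3 (C₁)]
-/

noncomputable section

-- single-problem summit (Problem = Summit): the mandated namespace repeats `HodgeConjecture`.
set_option linter.dupNamespace false

open CategoryTheory AlgebraicGeometry Bundle Topology
open Literature.AlgebraicGeometry.Motives Literature.AlgebraicGeometry.HodgeTheory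
open Literature.AlgebraicTopology.SingularHomology Literature.AlgebraicTopology.CharacteristicClasses

namespace Summit.HodgeConjecture.HodgeConjecture.Theorems

variable {n : ℕ} {X : SchemeOver ℂ} {F : X.left.Modules} {r : ℕ}

/-- **Local frame isomorphism.** Over `U(ℂ)`, for a Zariski open `U` carrying an algebraic frame `t` of
`F`, two comparison data restrict to framed bundles, isomorphic by an isomorphism carrying
`α_U(t_j)` to `α'_U(t_j)`. [cite: MilnorStasheff1974, §2 Thm. 2.2 and Lemma 2.3] [cite: SerreGAGA1956, §3 n°9 Déf. 2] -/
theorem exists_local_iso_of_comparison (E E' : ComplexVectorBundle.{0, 0} (ComplexPoints X))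
    (α : ∀ U : X.left.Opens, Γ(F, U) → ∀ P : ComplexPoints X, E.E P)
    (α' : ∀ U : X.left.Opens, Γ(F, U) → ∀ P : ComplexPoints X, E'.E P)
    (hcont : ∀ (U : X.left.Opens) (σ : Γ(F, U)),
      ContinuousOn (fun P ↦ (⟨P, α U σ P⟩ : TotalSpace E.F E.E)) {P | P.pt ∈ U})
    (hframe : ∀ (U : X.left.Opens) (t : Fin r → Γ(F, U)), IsSectionFrame F U t →
      ∀ P : ComplexPoints X, P.pt ∈ U → LinearIndependent ℂ (fun j ↦ α U (t j) P) ∧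
        ⊤ ≤ Submodule.span ℂ (Set.range fun j ↦ α U (t j) P))
    (hcont' : ∀ (U : X.left.Opens) (σ : Γ(F, U)),
      ContinuousOn (fun P ↦ (⟨P, α' U σ P⟩ : TotalSpace E'.F E'.E)) {P | P.pt ∈ U})
    (hframe' : ∀ (U : X.left.Opens) (t : Fin r → Γ(F, U)), IsSectionFrame F U t →
      ∀ P : ComplexPoints X, P.pt ∈ U → LinearIndependent ℂ (fun j ↦ α' U (t j) P) ∧
        ⊤ ≤ Submodule.span ℂ (Set.range fun j ↦ α' U (t j) P))
    {U : X.left.Opens} {t : Fin r → Γ(F, U)} (ht : IsSectionFrame F U t) :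
    ∃ e : (E.pullback (⟨Subtype.val, continuous_subtype_val⟩ : C(complexPointsCompl X ((U : X.left.Opens) : Set X.left)ᶜ, ComplexPoints X))).Iso (E'.pullback (⟨Subtype.val, continuous_subtype_val⟩ : C(complexPointsCompl X ((U : X.left.Opens) : Set X.left)ᶜ, ComplexPoints X))),
      ∀ (P : complexPointsCompl X ((U : Set X.left)ᶜ)) (j : Fin r), e.equiv P (α U (t j) P.1) = α' U (t j) P.1 := by
  refine ComplexVectorBundle.exists_iso_of_frames (E.pullback (⟨Subtype.val, continuous_subtype_val⟩ : C(complexPointsCompl X ((U : X.left.Opens) : Set X.left)ᶜ, ComplexPoints X))) (E'.pullback (⟨Subtype.val, continuous_subtype_val⟩ : C(complexPointsCompl X ((U : X.left.Opens) : Set X.left)ᶜ, ComplexPoints X)))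
    (fun j P ↦ α U (t j) P.1) (fun j P ↦ α' U (t j) P.1) (fun j ↦ ?_) (fun P ↦ ?_) (fun j ↦ ?_) (fun P ↦ ?_)
  · exact continuous_section_pullback_of_continuous E _ (fun P ↦ α U (t j) P.1)
      ((hcont U (t j)).comp_continuous continuous_subtype_val fun P ↦ Set.notMem_compl_iff.1 P.2)
  · exact hframe U t ht P.1 (Set.notMem_compl_iff.1 P.2)
  · exact continuous_section_pullback_of_continuous E' _ (fun P ↦ α' U (t j) P.1)
      ((hcont' U (t j)).comp_continuous continuous_subtype_val fun P ↦ Set.notMem_compl_iff.1 P.2)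
  · exact hframe' U t ht P.1 (Set.notMem_compl_iff.1 P.2)

/-- **Uniqueness of the fibre comparison** (step 4 in the form used here): two `ℂ`-linear maps
`E_P → E'_P` each carrying `α` to `α'` on SOME algebraic frame at `P` are equal — each then carries
`α` to `α'` on every section (`comparison_eq_of_frame`), in particular on the other's frame, a basis.
[cite: SerreGAGA1956, §3 n°9 Déf. 2 and Prop. 10] -/
theorem linearMap_eq_of_comparison {E E' : ComplexVectorBundle.{0, 0} (ComplexPoints X)}
    (α : ∀ U : X.left.Opens, Γ(F, U) → ∀ P : ComplexPoints X, E.E P)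
    (α' : ∀ U : X.left.Opens, Γ(F, U) → ∀ P : ComplexPoints X, E'.E P)
    (hadd : ∀ (U : X.left.Opens) (σ τ : Γ(F, U)) (P : ComplexPoints X), α U (σ + τ) P = α U σ P + α U τ P)
    (hsmul : ∀ (U : X.left.Opens) (f : Γ(X.left, U)) (σ : Γ(F, U)) (P : ComplexPoints X) (h : P.pt ∈ U),
      α U (f • σ) P = P.eval U h f • α U σ P)
    (hres : ∀ (U W : X.left.Opens) (hWU : W ≤ U) (σ : Γ(F, U)) (P : ComplexPoints X), P.pt ∈ W →
      α W (F.presheaf.map (homOfLE hWU).op σ) P = α U σ P)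
    (hframe : ∀ (U : X.left.Opens) (t : Fin r → Γ(F, U)), IsSectionFrame F U t →
      ∀ P : ComplexPoints X, P.pt ∈ U → LinearIndependent ℂ (fun j ↦ α U (t j) P) ∧
        ⊤ ≤ Submodule.span ℂ (Set.range fun j ↦ α U (t j) P))
    (hadd' : ∀ (U : X.left.Opens) (σ τ : Γ(F, U)) (P : ComplexPoints X), α' U (σ + τ) P = α' U σ P + α' U τ P)
    (hsmul' : ∀ (U : X.left.Opens) (f : Γ(X.left, U)) (σ : Γ(F, U)) (P : ComplexPoints X) (h : P.pt ∈ U),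
      α' U (f • σ) P = P.eval U h f • α' U σ P)
    (hres' : ∀ (U W : X.left.Opens) (hWU : W ≤ U) (σ : Γ(F, U)) (P : ComplexPoints X), P.pt ∈ W →
      α' W (F.presheaf.map (homOfLE hWU).op σ) P = α' U σ P)
    {P : ComplexPoints X} {U₁ U₂ : X.left.Opens} {t₁ : Fin r → Γ(F, U₁)} {t₂ : Fin r → Γ(F, U₂)}
    (ht₁ : IsSectionFrame F U₁ t₁) (ht₂ : IsSectionFrame F U₂ t₂) (h₁ : P.pt ∈ U₁) (h₂ : P.pt ∈ U₂)
    (Φ Ψ : E.E P →ₗ[ℂ] E'.E P) (hΦ : ∀ k, Φ (α U₁ (t₁ k) P) = α' U₁ (t₁ k) P)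
    (hΨ : ∀ k, Ψ (α U₂ (t₂ k) P) = α' U₂ (t₂ k) P) : Φ = Ψ := by
  letI : ∀ Q : ComplexPoints X, AddCommGroup (E.E Q) := fun Q ↦ Module.addCommMonoidToAddCommGroup ℂ
  letI : ∀ Q : ComplexPoints X, AddCommGroup (E'.E Q) := fun Q ↦ Module.addCommMonoidToAddCommGroup ℂ
  refine (Module.Basis.mk (hframe U₁ t₁ ht₁ P h₁).1 (hframe U₁ t₁ ht₁ P h₁).2).ext fun k ↦ ?_
  rw [Module.Basis.mk_apply, hΦ k]
  exact (comparison_eq_of_frame α α' hadd hsmul hres hadd' hsmul' hres' ht₂ h₂ Ψ hΨ (t₁ k) h₁).symm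

/-- **Two topological analytifications of one algebraic vector bundle are isomorphic, compatibly with
the comparison maps** (Serre's uniqueness of `F^h`, topologically): for comparison data `(E, α)`,
`(E', α')` of an `𝒪_X`-module `F` with algebraic frames of size `r` near every point, there is
`e : E ≅ E'` with `e(α_U(σ)(P)) = α'_U(σ)(P)` whenever `P.pt ∈ U`.
[cite: SerreGAGA1956, §3 n°9 Déf. 2 and Prop. 10] [cite: MilnorStasheff1974, §2 Thm. 2.2 and Lemma 2.3] -/
theorem exists_iso_of_comparison
    (hF : ∀ x : X.left, ∃ (U : X.left.Opens) (s : Fin r → Γ(F, U)), x ∈ U ∧ IsSectionFrame F U s)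
    (E E' : ComplexVectorBundle.{0, 0} (ComplexPoints X))
    (α : ∀ U : X.left.Opens, Γ(F, U) → ∀ P : ComplexPoints X, E.E P)
    (α' : ∀ U : X.left.Opens, Γ(F, U) → ∀ P : ComplexPoints X, E'.E P)
    (hadd : ∀ (U : X.left.Opens) (σ τ : Γ(F, U)) (P : ComplexPoints X), α U (σ + τ) P = α U σ P + α U τ P)
    (hsmul : ∀ (U : X.left.Opens) (f : Γ(X.left, U)) (σ : Γ(F, U)) (P : ComplexPoints X) (h : P.pt ∈ U),
      α U (f • σ) P = P.eval U h f • α U σ P)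
    (hres : ∀ (U W : X.left.Opens) (hWU : W ≤ U) (σ : Γ(F, U)) (P : ComplexPoints X), P.pt ∈ W →
      α W (F.presheaf.map (homOfLE hWU).op σ) P = α U σ P)
    (hcont : ∀ (U : X.left.Opens) (σ : Γ(F, U)),
      ContinuousOn (fun P ↦ (⟨P, α U σ P⟩ : TotalSpace E.F E.E)) {P | P.pt ∈ U})
    (hframe : ∀ (U : X.left.Opens) (t : Fin r → Γ(F, U)), IsSectionFrame F U t →
      ∀ P : ComplexPoints X, P.pt ∈ U → LinearIndependent ℂ (fun j ↦ α U (t j) P) ∧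
        ⊤ ≤ Submodule.span ℂ (Set.range fun j ↦ α U (t j) P))
    (hadd' : ∀ (U : X.left.Opens) (σ τ : Γ(F, U)) (P : ComplexPoints X), α' U (σ + τ) P = α' U σ P + α' U τ P)
    (hsmul' : ∀ (U : X.left.Opens) (f : Γ(X.left, U)) (σ : Γ(F, U)) (P : ComplexPoints X) (h : P.pt ∈ U),
      α' U (f • σ) P = P.eval U h f • α' U σ P)
    (hres' : ∀ (U W : X.left.Opens) (hWU : W ≤ U) (σ : Γ(F, U)) (P : ComplexPoints X), P.pt ∈ W →
      α' W (F.presheaf.map (homOfLE hWU).op σ) P = α' U σ P)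
    (hcont' : ∀ (U : X.left.Opens) (σ : Γ(F, U)),
      ContinuousOn (fun P ↦ (⟨P, α' U σ P⟩ : TotalSpace E'.F E'.E)) {P | P.pt ∈ U})
    (hframe' : ∀ (U : X.left.Opens) (t : Fin r → Γ(F, U)), IsSectionFrame F U t →
      ∀ P : ComplexPoints X, P.pt ∈ U → LinearIndependent ℂ (fun j ↦ α' U (t j) P) ∧
        ⊤ ≤ Submodule.span ℂ (Set.range fun j ↦ α' U (t j) P)) :
    ∃ e : E.Iso E', ∀ (U : X.left.Opens) (σ : Γ(F, U)) (P : ComplexPoints X), P.pt ∈ U →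
      e.equiv P (α U σ P) = α' U σ P := by
  -- frames at points, local isomorphisms over their complex points
  choose Uof sof hmem hfr using hF
  have hloc := fun (U : X.left.Opens) (t : Fin r → Γ(F, U)) (ht : IsSectionFrame F U t) ↦
    exists_local_iso_of_comparison E E' α α' hcont hframe hcont' hframe' ht
  choose eOf heOf using hloc
  -- the glued fibrewise equivalences (frame chosen at `P.pt`)
  have hPU : ∀ P : ComplexPoints X, P.pt ∉ ((Uof P.pt : X.left.Opens) : Set X.left)ᶜ :=
    fun P ↦ Set.notMem_compl_iff.2 (hmem P.pt)
  let φ : ∀ P : ComplexPoints X, E.E P ≃L[ℂ] E'.E P := fun P ↦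
    (eOf (Uof P.pt) (sof P.pt) (hfr P.pt)).equiv ⟨P, hPU P⟩
  -- `φ` matches `α` and `α'` on every section
  have hφ : ∀ (U : X.left.Opens) (σ : Γ(F, U)) (P : ComplexPoints X), P.pt ∈ U → φ P (α U σ P) = α' U σ P := by
    intro U σ P hP
    letI : ∀ Q : ComplexPoints X, AddCommGroup (E.E Q) := fun Q ↦ Module.addCommMonoidToAddCommGroup ℂ
    letI : ∀ Q : ComplexPoints X, AddCommGroup (E'.E Q) := fun Q ↦ Module.addCommMonoidToAddCommGroup ℂ
    exact comparison_eq_of_frame α α' hadd hsmul hres hadd' hsmul' hres' (hfr P.pt) (hmem P.pt)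
      ((φ P : E.E P →L[ℂ] E'.E P) : E.E P →ₗ[ℂ] E'.E P) (fun k ↦ heOf _ _ _ ⟨P, hPU P⟩ k) σ hP
  -- independence of the frame: `φ` agrees with EVERY local isomorphism
  have hind : ∀ (U : X.left.Opens) (t : Fin r → Γ(F, U)) (ht : IsSectionFrame F U t) (P : ComplexPoints X)
      (hP : P.pt ∉ ((U : Set X.left)ᶜ)) (v : E.E P), φ P v = (eOf U t ht).equiv ⟨P, hP⟩ v := by
    intro U t ht P hP v
    let ψ : E.E P ≃L[ℂ] E'.E P := (eOf U t ht).equiv ⟨P, hP⟩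
    have key := linearMap_eq_of_comparison α α' hadd hsmul hres hframe hadd' hsmul' hres'
      (hfr P.pt) ht (hmem P.pt) (Set.notMem_compl_iff.1 hP)
      ((φ P : E.E P →L[ℂ] E'.E P) : E.E P →ₗ[ℂ] E'.E P) ((ψ : E.E P →L[ℂ] E'.E P) : E.E P →ₗ[ℂ] E'.E P)
      (fun k ↦ heOf _ _ _ ⟨P, hPU P⟩ k) (fun k ↦ heOf U t ht ⟨P, hP⟩ k)
    exact congrArg (fun f : E.E P →ₗ[ℂ] E'.E P ↦ f v) key
  have hind' : ∀ (U : X.left.Opens) (t : Fin r → Γ(F, U)) (ht : IsSectionFrame F U t) (P : ComplexPoints X)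
      (hP : P.pt ∉ ((U : Set X.left)ᶜ)) (w : E'.E P), (φ P).symm w = ((eOf U t ht).equiv ⟨P, hP⟩).symm w := by
    intro U t ht P hP w
    apply (φ P).injective
    rw [ContinuousLinearEquiv.apply_symm_apply, hind U t ht P hP]
    exact (((eOf U t ht).equiv ⟨P, hP⟩).apply_symm_apply w).symm
  -- continuity is local: over `U(ℂ)` the glued map factors through the local isomorphism
  have hopen : ∀ U : X.left.Opens, IsOpen {q : TotalSpace E.F E.E | q.proj.pt ∈ U} := fun U ↦
    (AlgPoints.isOpen_setOf_pt_mem U).preimage (FiberBundle.continuous_proj E.F E.E)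
  have hopen' : ∀ U : X.left.Opens, IsOpen {q : TotalSpace E'.F E'.E | q.proj.pt ∈ U} := fun U ↦
    (AlgPoints.isOpen_setOf_pt_mem U).preimage (FiberBundle.continuous_proj E'.F E'.E)
  refine ⟨{ equiv := φ, continuous_toFun := ?_, continuous_invFun := ?_ }, hφ⟩
  · refine continuous_iff_continuousAt.2 fun q₀ ↦ ?_
    set U₀ := Uof q₀.proj.pt
    refine ((hopen U₀).mem_nhds (hmem q₀.proj.pt) |> fun hW ↦ ?_)
    refine ContinuousOn.continuousAt ?_ hW
    rw [continuousOn_iff_continuous_restrict]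
    -- the map into the restricted bundle `E|_{U₀(ℂ)}`
    let j : {q : TotalSpace E.F E.E | q.proj.pt ∈ U₀} →
        TotalSpace (E.pullback (⟨Subtype.val, continuous_subtype_val⟩ : C(complexPointsCompl X ((U₀ : X.left.Opens) : Set X.left)ᶜ, ComplexPoints X))).F (E.pullback (⟨Subtype.val, continuous_subtype_val⟩ : C(complexPointsCompl X ((U₀ : X.left.Opens) : Set X.left)ᶜ, ComplexPoints X))).E :=
      fun q ↦ ⟨⟨q.1.proj, Set.notMem_compl_iff.2 q.2⟩, q.1.2⟩
    have hj : Continuous j :=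
      (inducing_pullbackTotalSpaceEmbedding E.F E.E (⟨Subtype.val, continuous_subtype_val⟩ : C(complexPointsCompl X ((U₀ : X.left.Opens) : Set X.left)ᶜ, ComplexPoints X))).continuous_iff.2
        ((Continuous.subtype_mk ((FiberBundle.continuous_proj E.F E.E).comp continuous_subtype_val) _).prodMk
          continuous_subtype_val)
    have hcomp : Continuous ((Pullback.lift (⟨Subtype.val, continuous_subtype_val⟩ : C(complexPointsCompl X ((U₀ : X.left.Opens) : Set X.left)ᶜ, ComplexPoints X)) : TotalSpace E'.F ((⟨Subtype.val, continuous_subtype_val⟩ : C(complexPointsCompl X ((U₀ : X.left.Opens) : Set X.left)ᶜ, ComplexPoints X)) *ᵖ E'.E) → TotalSpace E'.F E'.E) ∘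
        (fun p : TotalSpace (E.pullback (⟨Subtype.val, continuous_subtype_val⟩ : C(complexPointsCompl X ((U₀ : X.left.Opens) : Set X.left)ᶜ, ComplexPoints X))).F (E.pullback (⟨Subtype.val, continuous_subtype_val⟩ : C(complexPointsCompl X ((U₀ : X.left.Opens) : Set X.left)ᶜ, ComplexPoints X))).E ↦
          (⟨p.proj, (eOf U₀ (sof _) (hfr _)).equiv p.proj p.2⟩ :
            TotalSpace (E'.pullback (⟨Subtype.val, continuous_subtype_val⟩ : C(complexPointsCompl X ((U₀ : X.left.Opens) : Set X.left)ᶜ, ComplexPoints X))).F (E'.pullback (⟨Subtype.val, continuous_subtype_val⟩ : C(complexPointsCompl X ((U₀ : X.left.Opens) : Set X.left)ᶜ, ComplexPoints X))).E)) ∘ j) :=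
      (Pullback.continuous_lift E'.F E'.E (⟨Subtype.val, continuous_subtype_val⟩ : C(complexPointsCompl X ((U₀ : X.left.Opens) : Set X.left)ᶜ, ComplexPoints X))).comp ((eOf U₀ (sof _) (hfr _)).continuous_toFun.comp hj)
    refine hcomp.congr fun q ↦ ?_
    change (⟨q.1.proj, (eOf U₀ (sof _) (hfr _)).equiv ⟨q.1.proj, _⟩ q.1.2⟩ : TotalSpace E'.F E'.E) = ⟨q.1.proj, φ q.1.proj q.1.2⟩
    rw [hind U₀ (sof _) (hfr _) q.1.proj (Set.notMem_compl_iff.2 q.2)]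
  · refine continuous_iff_continuousAt.2 fun q₀ ↦ ?_
    set U₀ := Uof q₀.proj.pt
    refine ((hopen' U₀).mem_nhds (hmem q₀.proj.pt) |> fun hW ↦ ?_)
    refine ContinuousOn.continuousAt ?_ hW
    rw [continuousOn_iff_continuous_restrict]
    let j : {q : TotalSpace E'.F E'.E | q.proj.pt ∈ U₀} →
        TotalSpace (E'.pullback (⟨Subtype.val, continuous_subtype_val⟩ : C(complexPointsCompl X ((U₀ : X.left.Opens) : Set X.left)ᶜ, ComplexPoints X))).F (E'.pullback (⟨Subtype.val, continuous_subtype_val⟩ : C(complexPointsCompl X ((U₀ : X.left.Opens) : Set X.left)ᶜ, ComplexPoints X))).E :=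
      fun q ↦ ⟨⟨q.1.proj, Set.notMem_compl_iff.2 q.2⟩, q.1.2⟩
    have hj : Continuous j :=
      (inducing_pullbackTotalSpaceEmbedding E'.F E'.E (⟨Subtype.val, continuous_subtype_val⟩ : C(complexPointsCompl X ((U₀ : X.left.Opens) : Set X.left)ᶜ, ComplexPoints X))).continuous_iff.2
        ((Continuous.subtype_mk ((FiberBundle.continuous_proj E'.F E'.E).comp continuous_subtype_val) _).prodMk
          continuous_subtype_val)
    have hcomp : Continuous ((Pullback.lift (⟨Subtype.val, continuous_subtype_val⟩ : C(complexPointsCompl X ((U₀ : X.left.Opens) : Set X.left)ᶜ, ComplexPoints X)) : TotalSpace E.F ((⟨Subtype.val, continuous_subtype_val⟩ : C(complexPointsCompl X ((U₀ : X.left.Opens) : Set X.left)ᶜ, ComplexPoints X)) *ᵖ E.E) → TotalSpace E.F E.E) ∘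
        (fun p : TotalSpace (E'.pullback (⟨Subtype.val, continuous_subtype_val⟩ : C(complexPointsCompl X ((U₀ : X.left.Opens) : Set X.left)ᶜ, ComplexPoints X))).F (E'.pullback (⟨Subtype.val, continuous_subtype_val⟩ : C(complexPointsCompl X ((U₀ : X.left.Opens) : Set X.left)ᶜ, ComplexPoints X))).E ↦
          (⟨p.proj, ((eOf U₀ (sof _) (hfr _)).equiv p.proj).symm p.2⟩ :
            TotalSpace (E.pullback (⟨Subtype.val, continuous_subtype_val⟩ : C(complexPointsCompl X ((U₀ : X.left.Opens) : Set X.left)ᶜ, ComplexPoints X))).F (E.pullback (⟨Subtype.val, continuous_subtype_val⟩ : C(complexPointsCompl X ((U₀ : X.left.Opens) : Set X.left)ᶜ, ComplexPoints X))).E)) ∘ j) :=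
      (Pullback.continuous_lift E.F E.E (⟨Subtype.val, continuous_subtype_val⟩ : C(complexPointsCompl X ((U₀ : X.left.Opens) : Set X.left)ᶜ, ComplexPoints X))).comp ((eOf U₀ (sof _) (hfr _)).continuous_invFun.comp hj)
    refine hcomp.congr fun q ↦ ?_
    change (⟨q.1.proj, ((eOf U₀ (sof _) (hfr _)).equiv ⟨q.1.proj, _⟩).symm q.1.2⟩ : TotalSpace E.F E.E) =
      ⟨q.1.proj, (φ q.1.proj).symm q.1.2⟩
    rw [hind' U₀ (sof _) (hfr _) q.1.proj (Set.notMem_compl_iff.2 q.2)]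

/-- **The Betti Chern classes of an algebraic vector bundle do not depend on the analytification
datum**: for `X` smooth projective and two comparison data `(E, α)`, `(E', α')` of the same
`𝒪_X`-module `F` (frames of size `r` near every point), `cᵢ(E) = cᵢ(E')` in `H²ⁱ(X(ℂ); ℤ)` ((C₁) for
the isomorphism `exists_iso_of_comparison`). [cite: HusemollerFibreBundles1994, Ch. 17 §3 (C₁)]
[cite: SerreGAGA1956, §3 n°9 Prop. 10] -/
theorem chernClassZ_eq_of_comparison (hX : IsSmoothProjective n X)
    (hF : ∀ x : X.left, ∃ (U : X.left.Opens) (s : Fin r → Γ(F, U)), x ∈ U ∧ IsSectionFrame F U s)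
    (E E' : ComplexVectorBundle.{0, 0} (ComplexPoints X))
    (α : ∀ U : X.left.Opens, Γ(F, U) → ∀ P : ComplexPoints X, E.E P)
    (α' : ∀ U : X.left.Opens, Γ(F, U) → ∀ P : ComplexPoints X, E'.E P)
    (hadd : ∀ (U : X.left.Opens) (σ τ : Γ(F, U)) (P : ComplexPoints X), α U (σ + τ) P = α U σ P + α U τ P)
    (hsmul : ∀ (U : X.left.Opens) (f : Γ(X.left, U)) (σ : Γ(F, U)) (P : ComplexPoints X) (h : P.pt ∈ U),
      α U (f • σ) P = P.eval U h f • α U σ P)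
    (hres : ∀ (U W : X.left.Opens) (hWU : W ≤ U) (σ : Γ(F, U)) (P : ComplexPoints X), P.pt ∈ W →
      α W (F.presheaf.map (homOfLE hWU).op σ) P = α U σ P)
    (hcont : ∀ (U : X.left.Opens) (σ : Γ(F, U)),
      ContinuousOn (fun P ↦ (⟨P, α U σ P⟩ : TotalSpace E.F E.E)) {P | P.pt ∈ U})
    (hframe : ∀ (U : X.left.Opens) (t : Fin r → Γ(F, U)), IsSectionFrame F U t →
      ∀ P : ComplexPoints X, P.pt ∈ U → LinearIndependent ℂ (fun j ↦ α U (t j) P) ∧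
        ⊤ ≤ Submodule.span ℂ (Set.range fun j ↦ α U (t j) P))
    (hadd' : ∀ (U : X.left.Opens) (σ τ : Γ(F, U)) (P : ComplexPoints X), α' U (σ + τ) P = α' U σ P + α' U τ P)
    (hsmul' : ∀ (U : X.left.Opens) (f : Γ(X.left, U)) (σ : Γ(F, U)) (P : ComplexPoints X) (h : P.pt ∈ U),
      α' U (f • σ) P = P.eval U h f • α' U σ P)
    (hres' : ∀ (U W : X.left.Opens) (hWU : W ≤ U) (σ : Γ(F, U)) (P : ComplexPoints X), P.pt ∈ W →
      α' W (F.presheaf.map (homOfLE hWU).op σ) P = α' U σ P)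
    (hcont' : ∀ (U : X.left.Opens) (σ : Γ(F, U)),
      ContinuousOn (fun P ↦ (⟨P, α' U σ P⟩ : TotalSpace E'.F E'.E)) {P | P.pt ∈ U})
    (hframe' : ∀ (U : X.left.Opens) (t : Fin r → Γ(F, U)), IsSectionFrame F U t →
      ∀ P : ComplexPoints X, P.pt ∈ U → LinearIndependent ℂ (fun j ↦ α' U (t j) P) ∧
        ⊤ ≤ Submodule.span ℂ (Set.range fun j ↦ α' U (t j) P)) (i : ℕ) :
    chernClassZ E i = chernClassZ E' i := by
  haveI := ComplexPoints.t2Space_of_isSmoothProjective hX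
  haveI := paracompactSpace_complexPoints_of_isSmoothProjective hX
  obtain ⟨e, -⟩ := exists_iso_of_comparison hF E E' α α' hadd hsmul hres hcont hframe hadd' hsmul' hres' hcont' hframe'
  exact theChernClassTheory.chernClass_congr e i

/-- The same with coefficients in any commutative ring `R` (e.g. the `ℂ`-valued classes in
`complexBetti X (2 * i)`): `cᵢ(E)_R = cᵢ(E')_R`. [cite: HusemollerFibreBundles1994, Ch. 17 §3 (C₁) and Ch. 20 §4] -/
theorem chernClassIn_eq_of_comparison (hX : IsSmoothProjective n X) (R : Type) [CommRing R]
    (hF : ∀ x : X.left, ∃ (U : X.left.Opens) (s : Fin r → Γ(F, U)), x ∈ U ∧ IsSectionFrame F U s)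
    (E E' : ComplexVectorBundle.{0, 0} (ComplexPoints X))
    (α : ∀ U : X.left.Opens, Γ(F, U) → ∀ P : ComplexPoints X, E.E P)
    (α' : ∀ U : X.left.Opens, Γ(F, U) → ∀ P : ComplexPoints X, E'.E P)
    (hadd : ∀ (U : X.left.Opens) (σ τ : Γ(F, U)) (P : ComplexPoints X), α U (σ + τ) P = α U σ P + α U τ P)
    (hsmul : ∀ (U : X.left.Opens) (f : Γ(X.left, U)) (σ : Γ(F, U)) (P : ComplexPoints X) (h : P.pt ∈ U),
      α U (f • σ) P = P.eval U h f • α U σ P)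
    (hres : ∀ (U W : X.left.Opens) (hWU : W ≤ U) (σ : Γ(F, U)) (P : ComplexPoints X), P.pt ∈ W →
      α W (F.presheaf.map (homOfLE hWU).op σ) P = α U σ P)
    (hcont : ∀ (U : X.left.Opens) (σ : Γ(F, U)),
      ContinuousOn (fun P ↦ (⟨P, α U σ P⟩ : TotalSpace E.F E.E)) {P | P.pt ∈ U})
    (hframe : ∀ (U : X.left.Opens) (t : Fin r → Γ(F, U)), IsSectionFrame F U t →
      ∀ P : ComplexPoints X, P.pt ∈ U → LinearIndependent ℂ (fun j ↦ α U (t j) P) ∧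
        ⊤ ≤ Submodule.span ℂ (Set.range fun j ↦ α U (t j) P))
    (hadd' : ∀ (U : X.left.Opens) (σ τ : Γ(F, U)) (P : ComplexPoints X), α' U (σ + τ) P = α' U σ P + α' U τ P)
    (hsmul' : ∀ (U : X.left.Opens) (f : Γ(X.left, U)) (σ : Γ(F, U)) (P : ComplexPoints X) (h : P.pt ∈ U),
      α' U (f • σ) P = P.eval U h f • α' U σ P)
    (hres' : ∀ (U W : X.left.Opens) (hWU : W ≤ U) (σ : Γ(F, U)) (P : ComplexPoints X), P.pt ∈ W →
      α' W (F.presheaf.map (homOfLE hWU).op σ) P = α' U σ P)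
    (hcont' : ∀ (U : X.left.Opens) (σ : Γ(F, U)),
      ContinuousOn (fun P ↦ (⟨P, α' U σ P⟩ : TotalSpace E'.F E'.E)) {P | P.pt ∈ U})
    (hframe' : ∀ (U : X.left.Opens) (t : Fin r → Γ(F, U)), IsSectionFrame F U t →
      ∀ P : ComplexPoints X, P.pt ∈ U → LinearIndependent ℂ (fun j ↦ α' U (t j) P) ∧
        ⊤ ≤ Submodule.span ℂ (Set.range fun j ↦ α' U (t j) P)) (i : ℕ) :
    theChernClassTheory.chernClassIn R E i = theChernClassTheory.chernClassIn R E' i := by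
  haveI := ComplexPoints.t2Space_of_isSmoothProjective hX
  haveI := paracompactSpace_complexPoints_of_isSmoothProjective hX
  obtain ⟨e, -⟩ := exists_iso_of_comparison hF E E' α α' hadd hsmul hres hcont hframe hadd' hsmul' hres' hcont' hframe'
  exact theChernClassTheory.chernClassIn_congr R e i

end Summit.HodgeConjecture.HodgeConjecture.Theorems

end
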